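import Literature.MathematicalPhysics.QuantumFieldTheory.Balaban1983to89.B13JointWalkExpansion

/-!
# Spine/NE5/TransportedWalks — a joint walk expansion READ THROUGH BLOCK-LOCAL CONTRACTIONS (row NE5's transport) is a
# joint walk expansion with the same letters (cell `pub-balaban-gaps`, seat `ne5` gen 5; companion of `Spine/NE5/TwoRunPencilWalks`)

WHY.  `Spine/NE5/TwoRunPencilWalks.jointWalkExpansion_pencil` compares two kernel families on the SAME row ∕ column index types.
Row NE5's two runs have different fine lattices (spacing η for run A, η∕L for run B); run A is read by run B's indices
THROUGH THE TRANSPORT (`T4OutputRate.NE5`: `EA g (C.transport U) X`, one block averaging [Balaban1985Averaging]) — at the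
kernel level: conjugation `Q_L · K_A(σ,u) · Q_R` by FIXED matrices that are BLOCK-LOCAL (an entry `Q_L i′ i ≠ 0` only when the
fine point `i` lies in the unit cube of `i′`: blocks of side `Lη ≤ 1` nest in the unit cubes of the current scale) and
ℓ¹-CONTRACTIVE (`Σ_i ‖Q_L i′ i‖ ≤ 1`, `Σ_j ‖Q_R j j′‖ ≤ 1`: averaging weights).  This file shows that such a conjugation maps
g1-p2's `B13JointWalkExpansion.JointWalkExpansion` (p349529 ✓) to a `JointWalkExpansion` with the SAME walk skeleton
`(W, SX, D, ρ)`, amplitudes, drop, torus rate and constant — termwise (`jointWalkExpansion_conj`); likewise `WalkMajorants`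
(`walkMajorants_conj`).  So the hypothesis «both runs are joint walk expansions on run B's index types» of the pencil theorem
costs nothing beyond run A's own walk data and the two displayed properties of the averaging matrices.

HONEST FRAMING.  Bookkeeping (finite sums) over ONE LANDED hypothesis SHAPE; the matrices `Q_L`, `Q_R`, their locality and
contractivity are HYPOTHESES (whether Bałaban's block averaging composed with his kernels has them, with which locators, is
NODE O ∕ row NE2 business); nothing of Bałaban's is constructed or asserted; NE5 NOT PRINTED ∕ NOT PROVED; (D4) NOT
discharged; spine PROVED 0∕9; rung (B)+1 on a FIXED finite T⁴ — NOT continuum, NOT infinite volume, NOT mass gap, NOT Clay.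
HONEST DEPENDENCY: continuum YM on T⁴ ⇐ BetaPertH ∧ nine spine estimates; BetaPertH ⇐ (D1) ∧ (D4) ∧ CAP+tail.  0 sorry, 0 def.

Sources: [II] = T. Bałaban, CMP **116** (1988) [Balaban1988RG2Cluster] (1.11) p. 5, p. 13; [B9] = CMP **99** (1985)
[Balaban1985BackgroundPropagators] Thm 3.10 p. 416; [B7] = CMP **98** (1985) [Balaban1985Averaging] (the block averaging
operation).  Nothing here is a claim about the Yang–Mills mass gap.
-/

noncomputable section

namespace Summit.QuantumFields.BalabanUV.T4Continuum.Spine.NE5.TransportedWalks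

open Metric Set Matrix Finset
open Literature.MathematicalPhysics.QuantumFieldTheory.Balaban1983to89
open Literature.MathematicalPhysics.QuantumFieldTheory.Balaban1983to89.B9SectDWalk (Through MajSumLe)
open Literature.MathematicalPhysics.QuantumFieldTheory.Balaban1983to89.B9Thm34Ext (toB6)
open Literature.MathematicalPhysics.QuantumFieldTheory.Balaban1983to89.B9Thm37GlueTorus (torusGeom tdist1 tdist1_nonneg)
open Literature.MathematicalPhysics.QuantumFieldTheory.Balaban1983to89.TreeLengthTorus (TPt)
open Literature.MathematicalPhysics.QuantumFieldTheory.Balaban1983to89.B5TorusCover (UT)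
open Literature.MathematicalPhysics.QuantumFieldTheory.Balaban1983to89.B13JointWalkExpansion
  (JointWalkExpansion WalkMajorants)

variable {d N' : ℕ} {ν : ℕ} {Nf : Fin ν → ℕ} [∀ i, NeZero (Nf i)]
variable {p n p' n' : Type} [Fintype p] [Fintype n]
variable {E : Type*} [NormedAddCommGroup E] [NormedSpace ℂ E]
variable {c : B13.Consts} {locp : p → UT Nf} {locn : n → UT Nf} {locp' : p' → UT Nf} {locn' : n' → UT Nf}
variable {K : (TPt d N' → ℂ) → E → Matrix p n ℂ}
variable {X : Finset (UT Nf)} {R ε kap Kbar : ℝ}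
variable {W : Type} {T : W → (TPt d N' → ℂ) → E → Matrix p n ℂ} {SX : Set W} {A : W → ℝ}
variable {D : W → UT Nf → UT Nf → ℝ} {ρ : ℝ}
variable {QL : Matrix p' p ℂ} {QR : Matrix n n' ℂ}

/-- **One conjugated entry is below the block envelope.**  If `‖M i j‖ ≤ B` whenever `Q_L i′ i ≠ 0` and `Q_R j j′ ≠ 0`, `B ≥ 0`,
and the rows of `Q_L` ∕ columns of `Q_R` are ℓ¹-contractive, then `‖(Q_L M Q_R) i′ j′‖ ≤ B` — also the form in which a termwise
two-run bound passes through the transport with the same modulus. [folklore] -/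
theorem norm_conj_entry_le {M : Matrix p n ℂ} {B : ℝ} (hB : 0 ≤ B) {i' : p'} {j' : n'}
    (hM : ∀ i j, QL i' i ≠ 0 → QR j j' ≠ 0 → ‖M i j‖ ≤ B)
    (hL : ∑ i, ‖QL i' i‖ ≤ 1) (hR : ∑ j, ‖QR j j'‖ ≤ 1) :
    ‖(QL * M * QR) i' j'‖ ≤ B := by
  have hpt : ∀ i j, ‖QL i' i‖ * ‖M i j‖ * ‖QR j j'‖ ≤ ‖QL i' i‖ * B * ‖QR j j'‖ := by
    intro i j
    by_cases hq : QL i' i = 0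
    · simp [hq]
    by_cases hr : QR j j' = 0
    · simp [hr]
    gcongr
    exact hM i j hq hr
  calc ‖(QL * M * QR) i' j'‖ = ‖∑ j, (∑ i, QL i' i * M i j) * QR j j'‖ := by simp only [Matrix.mul_apply, Finset.sum_mul]
    _ ≤ ∑ j, ‖(∑ i, QL i' i * M i j) * QR j j'‖ := norm_sum_le _ _
    _ ≤ ∑ j, (∑ i, ‖QL i' i‖ * ‖M i j‖) * ‖QR j j'‖ := by
        gcongr with j
        rw [norm_mul]
        gcongr
        exact (norm_sum_le _ _).trans (le_of_eq (Finset.sum_congr rfl fun i _ => norm_mul _ _))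
    _ = ∑ j, ∑ i, ‖QL i' i‖ * ‖M i j‖ * ‖QR j j'‖ := by simp only [Finset.sum_mul]
    _ ≤ ∑ j, ∑ i, ‖QL i' i‖ * B * ‖QR j j'‖ :=
        Finset.sum_le_sum fun j _ => Finset.sum_le_sum fun i _ => hpt i j
    _ = B * ((∑ i, ‖QL i' i‖) * ∑ j, ‖QR j j'‖) := by
        rw [Finset.sum_mul_sum, Finset.sum_comm, Finset.mul_sum]
        refine Finset.sum_congr rfl fun i _ => ?_
        rw [Finset.mul_sum]
        exact Finset.sum_congr rfl fun j _ => by ring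
    _ ≤ B * (1 * 1) :=
        mul_le_mul_of_nonneg_left (mul_le_mul hL hR (Finset.sum_nonneg fun _ _ => norm_nonneg _) zero_le_one) hB
    _ = B := by ring

/-- **A JOINT WALK EXPANSION READ THROUGH BLOCK-LOCAL CONTRACTIONS IS A JOINT WALK EXPANSION, SAME LETTERS.**  Conjugating the
kernel family and every walk term by fixed matrices `Q_L` (new rows `p′`) and `Q_R` (new columns `n′`) that are block-local
for the locators (`Q_L i′ i ≠ 0 → loc i = loc′ i′`, `Q_R j j′ ≠ 0 → loc j = loc′ j′`) and ℓ¹-contractive preserves: the entrywise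
expansion (finite sums of `HasSum`), termwise analyticity (finite sums), the per-term bounds with the SAME amplitude and walk
distance (the envelope is constant on a block), the partial-sum majorant (unchanged: same `A`, `D`), and the σ-structure.
[cite: Balaban1988RG2Cluster, (1.11) p.5, p.13; Balaban1985BackgroundPropagators, Thm 3.10 p.416] -/
theorem jointWalkExpansion_conj (h : JointWalkExpansion c locp locn K X R ε kap Kbar T SX A D ρ)
    (hLloc : ∀ i' i, QL i' i ≠ 0 → locp i = locp' i') (hRloc : ∀ j j', QR j j' ≠ 0 → locn j = locn' j')
    (hL : ∀ i', ∑ i, ‖QL i' i‖ ≤ 1) (hR : ∀ j', ∑ j, ‖QR j j'‖ ≤ 1) :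
    JointWalkExpansion c locp' locn' (fun σ u => QL * K σ u * QR) X R ε kap Kbar
      (fun ω σ u => QL * T ω σ u * QR) SX A D ρ where
  hasSum σ hσ u hu i' j' := by
    simp only [Matrix.mul_apply, Finset.sum_mul]
    refine hasSum_sum fun j _ => hasSum_sum fun i _ => ?_
    exact ((h.hasSum σ hσ u hu i j).mul_left (QL i' i)).mul_right (QR j j')
  termAnalytic ω σ hσ i' j' := by
    simp only [Matrix.mul_apply, Finset.sum_mul]
    refine DifferentiableOn.fun_sum fun j _ => DifferentiableOn.fun_sum fun i _ => ?_
    exact ((h.termAnalytic ω σ hσ i j).const_mul (QL i' i)).mul_const (QR j j')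
  maj ω σ hσ u hu i' j' :=
    norm_conj_entry_le (mul_nonneg (h.A_nonneg ω) (Real.exp_pos _).le)
      (fun i j hq hr => by rw [← hLloc i' i hq, ← hRloc j j' hr]; exact h.maj ω σ hσ u hu i j) (hL i') (hR j')
  majSum := h.majSum
  indep ω hω σ hσ := by simp only [h.indep ω hω σ hσ]
  through := h.through
  A_nonneg := h.A_nonneg
  D_nonneg := h.D_nonneg

omit [NormedSpace ℂ E] in
/-- The covariance's weaker triple read through block-local contractions. [cite: Balaban1985BackgroundPropagators, (3.108) p.416] -/
theorem walkMajorants_conj (h : WalkMajorants c locp locn K R kap Kbar T A D ρ)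
    (hLloc : ∀ i' i, QL i' i ≠ 0 → locp i = locp' i') (hRloc : ∀ j j', QR j j' ≠ 0 → locn j = locn' j')
    (hL : ∀ i', ∑ i, ‖QL i' i‖ ≤ 1) (hR : ∀ j', ∑ j, ‖QR j j'‖ ≤ 1) :
    WalkMajorants c locp' locn' (fun σ u => QL * K σ u * QR) R kap Kbar (fun ω σ u => QL * T ω σ u * QR) A D ρ where
  hasSum σ hσ u hu i' j' := by
    simp only [Matrix.mul_apply, Finset.sum_mul]
    refine hasSum_sum fun j _ => hasSum_sum fun i _ => ?_
    exact ((h.hasSum σ hσ u hu i j).mul_left (QL i' i)).mul_right (QR j j')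
  maj ω σ hσ u hu i' j' :=
    norm_conj_entry_le (mul_nonneg (h.A_nonneg ω) (Real.exp_pos _).le)
      (fun i j hq hr => by rw [← hLloc i' i hq, ← hRloc j j' hr]; exact h.maj ω σ hσ u hu i j) (hL i') (hR j')
  majSum := h.majSum
  A_nonneg := h.A_nonneg

end Summit.QuantumFields.BalabanUV.T4Continuum.Spine.NE5.TransportedWalks

end
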